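import Literature.NumberTheory.GaloisRepresentations.IdeleCohomologyLimit
import Literature.NumberTheory.GaloisRepresentations.IdeleLocalInvariantsCanonical
import Literature.NumberTheory.GaloisRepresentations.IdeleLocalInvariantsInflation
import HarnessLib

/-!
# `H²(Gal(E/F), J_{E,S})` read by the local invariants at the places of `S` (base field totally complex):
# joint injectivity, image `⊕_{v ∈ S} (1/n_v)ℤ/ℤ`, the classes of `H²(G, J_E)` supported on `S`, and inflation
# (Tate, C–F VII §7.3 Prop. 7.3 / Cor. 7.4 (b), §8; Harari Prop. 13.1 (b); NSW (8.3.11) finite-layer input)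

Topic `NumberTheory/GaloisRepresentations`; namespace `Literature.NumberTheory.GaloisRepresentations.IdeleCohomology`,
continuing `IdeleSUnitsCohomology.lean` (`J_{E,S} = ideleSRep F E S` and its blocks), `IdeleCohomologyLimit.lean`
(`Hⁿ(G, J_{E,S}) ↪ Hⁿ(G, J_E)` for `S ⊇ ram`, `map_ideleSRepHom_injective`; Prop. 7.3 elementwise; **`H³(G, J_{E,S}) = 0`,
`isZero_H3_ideleSRep`, is ALREADY there** and is not restated), `IdeleLocalInvariants{,Range,Canonical,Inflation}.lean`
(`inv_v = localInv E v : H²(G, J_E) →+ ℚ/ℤ`, `n_v = localDegree E v`, `range_unitsInvAt`, `localInv_ideleInf`).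
THEOREMS ONLY (no definition, no named fact, no `sorry`, no instance); number fields in `Type`.  Cell `bsd-eis`, lane
«PT3-TC» (Harari Thm. 17.13 (a) at totally complex fields via NSW (8.3.18)), brick (A3a) of the ORDER OF WORK of width seat
w8 gen 9 (2026-08-28): the finite-layer idèle input of the diagram chase NSW (8.3.11) (iii)/(iv) — there one needs, for a
finite Galois layer `E/F` inside `F_S` (so `S ⊇` the places ramified in `E`), that `H³(G, J_{E,S}) = 0` (tree) and that
`H²(G, J_{E,S}) ≅ ⊕_{v ∈ S} (1/n_{v,E})ℤ/ℤ` by the local invariants, compatibly with inflation `E ⊂ E'`.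

Mathematics (Tate, C–F VII §7.3 [held copy p0217]: "`Ĥ^r(G, J_{L,S}) ≃ ∏_{v ∈ S} Ĥ^r(G^v, (L^v)^*)`, by 7.2" and Cor. 7.4
(b) "`H²(G, J_L) ≃ ∐_v (1/n_v)ℤ/ℤ, where n_v = [L^v : K_v]`"; Harari Prop. 13.1 (b) [held copy p0203–0204]).  Write
`π_S : H²(G, J_{E,S}) → H²(G, J_E)` for `H²` of the inclusion (`groupCohomology.map (MonoidHom.id G) (ideleSRepHom S) 2`).
For `S ⊇ ram(E/F)`: the invariants of `π_S c` vanish off `S` (the `v`-block of `J_{E,S}` at `v ∉ S` is the unit block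
`∏_{w∣v} 𝒪_wˣ`, cohomologically trivial); over a TOTALLY COMPLEX `F` the archimedean invariants of EVERY class of
`H²(G, J_E)` vanish (decomposition groups at the infinite places are trivial).  Hence (Prop. 7.3: a class is determined by
its components, each component by its invariant) `c ↦ (inv_v(π_S c))_{v ∈ S}` is injective on `H²(G, J_{E,S})`, its image
is `{(a_v) : n_v a_v = 0}` (local class field theory: `inv_w : H²(G_w, E_wˣ) ≅ (1/n_v)ℤ/ℤ`, block by block), the range of
`π_S` is the set of classes of `H²(G, J_E)` whose invariants are supported on `S`, and in a tower `F ⊆ E ⊆ E'` the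
inflation of `π_S c` lies in the range of `π_S` for `E'` with the same invariants (`inv_v ∘ Inf = inv_v`).

## What is formalised (`F E E' : Type` number fields, `E/F` Galois, `G = E ≃ₐ[F] E`, `S : Finset (HeightOneSpectrum (𝓞 F))`,
## `hS : S ⊇ ram(E/F)` as `∀ v ∉ S, Algebra.IsUnramifiedIn (𝓞 E) v.asIdeal`)

* §1 `isZero_groupCohomology_archUnitsRep_of_isTotallyComplex` (`Hⁿ(G, ∏_{w∣v} E_wˣ) = 0`, `n ≥ 1`, `v ∣ ∞`, `F` totally
  complex), `localInvInfAt_eq_zero_of_isTotallyComplex` (every archimedean invariant of every class of `H²(G, J_E)` vanishes).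
* §2 `localInv_map_ideleSRepHom_eq_zero_of_notMem` (invariants of `π_S c` vanish off `S`),
  **`eq_zero_of_forall_mem_localInv_eq_zero`** (joint injectivity of `(inv_v ∘ π_S)_{v ∈ S}`, `F` totally complex),
  **`exists_forall_localInv_eq`** / `exists_forall_mem_localInv_eq` (every family `(a_v)_{v ∈ S}` with `n_v a_v = 0` is
  realised; indexed by the subtype of `S`, resp. by `v ∈ S`), with the tree's `natCard_stabilizer_nsmul_localInvAt` for
  `n_v · inv_v = 0`.
* §3 **`mem_range_map_ideleSRepHom_iff`** (`F` totally complex: `c ∈ range π_S ↔` the invariants of `c` vanish off `S`),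
  **`exists_map_ideleSRepHom_eq_ideleInf`** (tower `F ⊆ E ⊆ E'`, `S ⊇ ram(E'/F)`: `Inf (π_S c) = π_S c'` for some
  `c' ∈ H²(Gal(E'/F), J_{E',S})`; its invariants at `v ∈ S` are those of `c` by the tree's `localInv_ideleInf`).

HONEST FRAMING: finite-layer bookkeeping on the tree's idèle cohomology; nothing here is Poitou–Tate 17.13 (a) itself, and
no statement of any summit is proved.

## References
* J. W. S. Cassels, A. Fröhlich (eds.), *Algebraic Number Theory* (1967), Ch. VII (J. Tate) §7.3 Prop. 7.3, Cor. 7.4 (b),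
  §8, §11.2. [CasselsFrohlichANT1967]
* D. Harari, *Galois Cohomology and Class Field Theory*, Universitext, Springer (2020), §13.1 Prop. 13.1 (b), Cor. 13.2.
  [Harari2020]
* J. Neukirch, A. Schmidt, K. Wingberg, *Cohomology of Number Fields*, 2nd ed. (2008), VIII §3, (8.3.11). [NeukirchSchmidtWingberg2008]
-/

noncomputable section

open NumberField IsDedekindDomain CategoryTheory CategoryTheory.Limits groupCohomology
open Literature.NumberTheory.Automorphic

namespace Literature.NumberTheory.GaloisRepresentations

namespace IdeleCohomology

open Literature.Algebra.Homology SemiLocal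

variable {F : Type} [Field F] [NumberField F] {E : Type} [Field E] [NumberField E] [Algebra F E]

/-! ## §1. Over a totally complex base the archimedean blocks and invariants vanish -/

/-- **`Hⁿ(Gal(E/F), ∏_{w∣v} E_wˣ) = 0` for `n ≥ 1` at every infinite place `v` of a TOTALLY COMPLEX `F`** (every place of
`E` above `v` is unramified over `F` — its restriction is complex —, so the tree's
`ArchHerbrand.isZero_groupCohomology_archUnitsRep` applies). [cite: Harari2020, §13.1 Prop. 13.1 (b) (proof)]
[cite: CasselsFrohlichANT1967, Ch. VII §7.2] -/
theorem isZero_groupCohomology_archUnitsRep_of_isTotallyComplex [IsGalois F E] [IsTotallyComplex F]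
    (v : InfinitePlace F) (n : ℕ) :
    IsZero (groupCohomology (ArchHerbrand.archUnitsRep (E := E) v) (n + 1)) := by
  haveI : Fintype (E ≃ₐ[F] E) := Fintype.ofFinite _
  obtain ⟨w₀, rfl⟩ := InfinitePlace.comap_surjective (K := E) (k := F) v
  exact ArchHerbrand.isZero_groupCohomology_archUnitsRep w₀
    ((InfinitePlace.isUnramified_iff).2 (Or.inr (IsTotallyComplex.isComplex _))) n

/-- **Over a totally complex `F` every archimedean invariant of every class of `H²(Gal(E/F), J_E)` vanishes** (read at
ANY place `w₀` of `E`: the archimedean block `H²(G, ∏_{w∣v} E_wˣ)` is zero). [cite: CasselsFrohlichANT1967, Ch. VII §7.3 Cor. 7.4 (b)] -/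
theorem localInvInfAt_eq_zero_of_isTotallyComplex [IsGalois F E] [IsTotallyComplex F] (w₀ : InfinitePlace E)
    (c : groupCohomology (IdeleClassGroup.ideleRep F E) 2) : localInvInfAt (F := F) w₀ c = 0 := by
  rw [localInvInfAt_eq_zero_iff]
  haveI := ModuleCat.subsingleton_of_isZero
    (isZero_groupCohomology_archUnitsRep_of_isTotallyComplex (E := E) (w₀.comap (algebraMap F E)) 1)
  exact Subsingleton.elim _ _

/-! ## §2. The invariants of `H²(G, J_{E,S})` at the places of `S`: joint injectivity and image -/

variable (S : Finset (HeightOneSpectrum (𝓞 F)))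

/-- **The invariants of a class coming from `J_{E,S}` vanish off `S`** (`S ⊇ ram(E/F)`): at `v ∉ S` the `v`-component of
`J_{E,S}` factors through the unit block `∏_{w∣v} 𝒪_wˣ`, whose `H²` is zero (unramified local units are
cohomologically trivial). [cite: CasselsFrohlichANT1967, Ch. VII §7.3][cite: Harari2020, §13.1 Prop. 13.1 (b) (proof)] -/
theorem localInv_map_ideleSRepHom_eq_zero_of_notMem [IsGalois F E]
    (hS : ∀ v : HeightOneSpectrum (𝓞 F), v ∉ S → Algebra.IsUnramifiedIn (𝓞 E) v.asIdeal)
    {v : HeightOneSpectrum (𝓞 F)} (hv : v ∉ S) (c : groupCohomology (ideleSRep F E S) 2) :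
    localInv E v (groupCohomology.map (MonoidHom.id (E ≃ₐ[F] E)) (ideleSRepHom S) 2 c) = 0 := by
  rw [localInv_eq_zero_iff, ← map_comp_apply, ideleSRepHom_comp_placeProj, ← blockUnitGroup_comp_unitGroupRepHom S hv,
    map_comp_apply]
  haveI := ModuleCat.subsingleton_of_isZero (SemiLocal.isZero_groupCohomology_unitGroupRep' (E := E) v (hS v hv) 2)
  rw [Subsingleton.elim (groupCohomology.map (MonoidHom.id (E ≃ₐ[F] E)) (blockUnitGroup S hv) 2 c) 0, map_zero]

/-- **Joint injectivity of the invariants at the places of `S`** (`F` totally complex, `S ⊇ ram(E/F)`): a class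
`c ∈ H²(Gal(E/F), J_{E,S})` all of whose invariants `inv_v(π_S c)`, `v ∈ S`, vanish is zero — off `S` and at the infinite
places the invariants of `π_S c` vanish anyway, so `π_S c = 0` (Tate's Prop. 7.3: a class of `H²(G, J_E)` with all local
invariants zero is zero), and `π_S` is injective. [cite: CasselsFrohlichANT1967, Ch. VII §7.3 Prop. 7.3, Cor. 7.4 (b)]
[cite: Harari2020, §13.1 Prop. 13.1 (b)] -/
theorem eq_zero_of_forall_mem_localInv_eq_zero [IsGalois F E] [IsTotallyComplex F]
    (hS : ∀ v : HeightOneSpectrum (𝓞 F), v ∉ S → Algebra.IsUnramifiedIn (𝓞 E) v.asIdeal)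
    (c : groupCohomology (ideleSRep F E S) 2)
    (h : ∀ v ∈ S, localInv E v (groupCohomology.map (MonoidHom.id (E ≃ₐ[F] E)) (ideleSRepHom S) 2 c) = 0) :
    c = 0 := by
  have h0 : groupCohomology.map (MonoidHom.id (E ≃ₐ[F] E)) (ideleSRepHom S) 2 c = 0 := by
    refine eq_zero_of_forall_localInv_eq_zero _ (fun v => ?_) (fun w₀ => ?_)
    · by_cases hv : v ∈ S
      · exact h v hv
      · exact localInv_map_ideleSRepHom_eq_zero_of_notMem S hS hv c
    · exact localInvInfAt_eq_zero_of_isTotallyComplex w₀ _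
  have hinj := map_ideleSRepHom_injective (E := E) S hS 2
  apply hinj
  simp only [map_zero]
  exact h0

/-- **Every family `(a_v)_{v ∈ S}` with `n_v · a_v = 0` is the family of invariants of a class of `H²(Gal(E/F), J_{E,S})`**
(`n_v = localDegree E v = [E_w : F_v]`; indexed by the subtype of `S`): block by block, `inv_w : H²(G_w, E_wˣ) → (1/n_v)ℤ/ℤ`
is ONTO (local class field theory, the tree's `range_unitsInvAt`), and `J_{E,S}` is the direct product of its blocks
(`blockProj_bijective`), the blocks off `S` and at infinity being set to `0`. [cite: CasselsFrohlichANT1967, Ch. VII §7.3 Cor. 7.4 (b)]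
[cite: SerreLocalFields1979, Ch. XIII §3 Prop. 6] -/
theorem exists_forall_localInv_eq [IsGalois F E] (a : HeightOneSpectrum (𝓞 F) → AddCircle (1 : ℚ))
    (ha : ∀ v ∈ S, localDegree E v • a v = 0) :
    ∃ c : groupCohomology (ideleSRep F E S) 2, ∀ v : {v : HeightOneSpectrum (𝓞 F) // v ∈ S},
      localInv E v.1 (groupCohomology.map (MonoidHom.id (E ≃ₐ[F] E)) (ideleSRepHom S) 2 c) = a v.1 := by
  -- a block class with the prescribed invariant at each `v ∈ S` (local class field theory: `inv_w` is onto `(1/n_v)ℤ/ℤ`)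
  have hb : ∀ v : {v : HeightOneSpectrum (𝓞 F) // v ∈ S},
      ∃ b : groupCohomology (SemiLocal.unitsRep F E v.1) 2, unitsInvAt (chosenPlace (E := E) v.1) b = a v.1 := by
    intro v
    have hmem : a v.1 ∈ Set.range (unitsInvAt (chosenPlace (E := E) v.1)) := by
      rw [range_unitsInvAt, ← localDegree_eq_natCard_stabilizer (chosenPlace (E := E) v.1)]
      exact ha v.1 v.2
    exact hmem
  -- `J_{E,S}` is the product of its blocks: a class with the chosen blocks on `S` and `0` off `S` and at infinity
  let t : ∀ i : BlockIndex S, groupCohomology (blockFamily E S i) 2 := fun i =>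
    match i with
    | Sum.inl v => (hb v).choose
    | Sum.inr (Sum.inl _) => 0
    | Sum.inr (Sum.inr _) => 0
  obtain ⟨c, hc⟩ := (GroupCohomologyPi.map_pi_bijective (blockProj_bijective S) 2).2 t
  refine ⟨c, fun v => ?_⟩
  have hcv : groupCohomology.map (MonoidHom.id (E ≃ₐ[F] E)) (blockUnits S v.1) 2 c = (hb v).choose :=
    congrFun hc (Sum.inl v)
  have e1 : localInv E v.1 (groupCohomology.map (MonoidHom.id (E ≃ₐ[F] E)) (ideleSRepHom S) 2 c) =
      unitsInvAt (chosenPlace (E := E) v.1)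
        (groupCohomology.map (MonoidHom.id (E ≃ₐ[F] E)) (blockUnits S v.1) 2 c) := by
    rw [localInv_eq_localInvAt (chosenPlace (E := E) v.1), localInvAt_eq_unitsInvAt, ← map_comp_apply,
      ideleSRepHom_comp_placeProj]
  rw [e1, hcv]
  exact (hb v).choose_spec

/-- **The same, indexed by `v ∈ S`** (the form the consumers quantify in). [cite: CasselsFrohlichANT1967, Ch. VII §7.3 Cor. 7.4 (b)] -/
theorem exists_forall_mem_localInv_eq [IsGalois F E] (a : HeightOneSpectrum (𝓞 F) → AddCircle (1 : ℚ))
    (ha : ∀ v ∈ S, localDegree E v • a v = 0) :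
    ∃ c : groupCohomology (ideleSRep F E S) 2,
      ∀ v ∈ S, localInv E v (groupCohomology.map (MonoidHom.id (E ≃ₐ[F] E)) (ideleSRepHom S) 2 c) = a v := by
  obtain ⟨c, hc⟩ := exists_forall_localInv_eq (E := E) S a ha
  refine ⟨c, fun v hv => ?_⟩
  -- (the projection `(⟨v, hv⟩ : S).1` is normalised syntactically: definitional unfolding through `localInv` is costly)
  have h := hc ⟨v, hv⟩
  simp only at h
  exact h

/-! ## §3. The classes of `H²(G, J_E)` supported on `S`; inflation -/

/-- **`range π_S` = the classes of `H²(Gal(E/F), J_E)` whose invariants are supported on `S`** (`F` totally complex,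
`S ⊇ ram(E/F)`): `⇒` by `localInv_map_ideleSRepHom_eq_zero_of_notMem`; `⇐`: realise the invariants `(inv_v c)_{v ∈ S}`
(they satisfy `n_v · inv_v c = 0`) by a class `c'` of `H²(G, J_{E,S})`, then `π_S c' − c` has all invariants zero.
[cite: CasselsFrohlichANT1967, Ch. VII §7.3 Prop. 7.3, Cor. 7.4 (b)][cite: Harari2020, §13.1 Prop. 13.1 (b)] -/
theorem mem_range_map_ideleSRepHom_iff [IsGalois F E] [IsTotallyComplex F]
    (hS : ∀ v : HeightOneSpectrum (𝓞 F), v ∉ S → Algebra.IsUnramifiedIn (𝓞 E) v.asIdeal)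
    (c : groupCohomology (IdeleClassGroup.ideleRep F E) 2) :
    (∃ c' : groupCohomology (ideleSRep F E S) 2,
        groupCohomology.map (MonoidHom.id (E ≃ₐ[F] E)) (ideleSRepHom S) 2 c' = c) ↔
      ∀ v : HeightOneSpectrum (𝓞 F), v ∉ S → localInv E v c = 0 := by
  constructor
  · rintro ⟨c', rfl⟩ v hv
    exact localInv_map_ideleSRepHom_eq_zero_of_notMem S hS hv c'
  · intro h
    obtain ⟨c', hc'⟩ := exists_forall_mem_localInv_eq (E := E) S (fun v => localInv E v c) (fun v _ => by
      rw [localDegree_eq_natCard_stabilizer (chosenPlace (E := E) v), localInv_eq_localInvAt (chosenPlace (E := E) v)]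
      exact natCard_stabilizer_nsmul_localInvAt _ c)
    refine ⟨c', sub_eq_zero.mp (eq_zero_of_forall_localInv_eq_zero _ (fun v => ?_) (fun w₀ => ?_))⟩
    · rw [map_sub]
      by_cases hv : v ∈ S
      · rw [hc' v hv, sub_self]
      · rw [localInv_map_ideleSRepHom_eq_zero_of_notMem S hS hv c', h v hv, sub_self]
    · rw [map_sub, localInvInfAt_eq_zero_of_isTotallyComplex, localInvInfAt_eq_zero_of_isTotallyComplex, sub_self]

/-- **Inflation keeps `S`-supported classes `S`-supported**: in a tower `F ⊆ E ⊆ E'` of finite Galois extensions of a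
totally complex `F`, with `S ⊇ ram(E/F)` and `S ⊇ ram(E'/F)`, the inflation of `π_S c` (`c ∈ H²(Gal(E/F), J_{E,S})`) is
`π_S c'` for a class `c' ∈ H²(Gal(E'/F), J_{E',S})` — because `inv_v(Inf x) = inv_v(x)` (tree `localInv_ideleInf`) and the
range of `π_S` is the set of `S`-supported classes.  The invariants of `c'` at `v ∈ S` are those of `c`, again by
`localInv_ideleInf`. [cite: CasselsFrohlichANT1967, Ch. VII §8, §11.1][cite: SerreLocalFields1979, Ch. XI §2–§3] -/
theorem exists_map_ideleSRepHom_eq_ideleInf [IsTotallyComplex F] {E' : Type} [Field E'] [NumberField E']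
    [Algebra E E'] [Algebra F E'] [IsScalarTower F E E'] [Normal F E] [IsGalois F E] [IsGalois F E']
    (hS' : ∀ v : HeightOneSpectrum (𝓞 F), v ∉ S → Algebra.IsUnramifiedIn (𝓞 E') v.asIdeal)
    (hS : ∀ v : HeightOneSpectrum (𝓞 F), v ∉ S → Algebra.IsUnramifiedIn (𝓞 E) v.asIdeal)
    (c : groupCohomology (ideleSRep F E S) 2) :
    ∃ c' : groupCohomology (ideleSRep F E' S) 2,
      groupCohomology.map (MonoidHom.id (E' ≃ₐ[F] E')) (ideleSRepHom S) 2 c' =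
        ideleInf F E E' 2 (groupCohomology.map (MonoidHom.id (E ≃ₐ[F] E)) (ideleSRepHom S) 2 c) := by
  refine (mem_range_map_ideleSRepHom_iff (E := E') S hS' _).mpr fun v hv => ?_
  rw [localInv_ideleInf, localInv_map_ideleSRepHom_eq_zero_of_notMem S hS hv c]

end IdeleCohomology

end Literature.NumberTheory.GaloisRepresentations

end
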